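import Summits.Schanuel.Schanuel.Theorems.RootDecomp1BProductCell02

/-!
# RootDecomp1BProductCell — lens 4, generation 46 «PRODUCT CELL: TWO INDEPENDENT LIOUVILLE COORDINATES VIA THE QUANTITATIVE STOREY-ONE CELL» (CLAIM L2339, PRICE + CHECKLIST B-g46 L2340, NODE L2399 / REQUEST L2400, critic VERDICT L2407: CLEARED — THEOREM ×1 (K1 twoRadical_lower, the composable quantitative engine) + ONE CELL «RATE-MATCHED PRODUCT 𝒜_W × ℬ_W» (K2 algebraicIndependent_product + cells); RULE B-R33; PORT GO) — continuation (RootDecomp1BProductCell03): §3b the upper half of the clash over the transcendental base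

(lens-4 g46 HOME kernel K = HOME/decomp-schanuel-lens-4/g46/ProductCell.lean d6cd9943…, 1931 l, ONE import …RootDecomp1BTwoRadical05; P/C + NODE-g46.md 601195d2…. Port by census-1 gen 20 as `RootDecomp1BProductCell01–08` from the census CAP EDITION ProductCell.capped.lean (K2 `algebraicIndependent_product` is ONE 398-line declaration block > the 400-line file cap: its step (3) «thrP(N) ≤ exp(c_T q⁴)» — four exponential bounds, context-free — is extracted as the public lemma `thr_le_exp_quartic` in §3c with the local abbreviations passed as variables and the defining equation of c_T as a hypothesis; K2's STATEMENT byte-identical, all 87 K decl signatures identical, +1 decl; farm rc 0 · 0/0/0 · axioms std on K2): 01 = §1 Lipschitz (`FrelC`, `lam`, `lipschitz_Frel₂_explicit`) + §2 root avoidance (`fibreSum_ne_zero`); 02 = §3 K1 `thr`, `bigTheta`, `thrP`, **`twoRadical_lower`**; 03 = §3b outer upper half (`norm_normForm_le`, `normForm_len_le`); 04 = §3c `thr_le`, `thr_le_exp_quartic` (cap lemma) + §4 classes `UltraLiouvilleSW` / `TowerLiouville` («[class] definition» tags) + `thr_nonneg` + §5 prelude `thetaS`; 05 = §5 K2 **`algebraicIndependent_product`**;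 06 = §6 law `sw`, members `ultraLiouvilleSW_rhoU` (tree rhoU), `gT`/`vT`/`tTerm`/`rhoT`/`tNum`/`tRat`, `towerLiouville_rhoT`; 07 = §7 cells `algebraicIndependent_eight_of_pos`, `eight_le_polarDeg_one_pair`, `six_le_polarDeg_one_pair`, `schanuel_body_one_pair`, `six_le_polarDeg_pair`, `four_le_polarDeg_pair`, `schanuel_body_pair`, named pair (ρ_U, ρ_T) hyp-free; 08 = §8 `E₅`, `thrP_le_exp`, `transcMeasure_thetaS`, `transcMeasure_rhoU`. PORT EDITS (VERDICT L2407 (a)–(d) + the cap edition): linter option dropped; 26 one-line docstrings added; class tags in the census wording; scoped heartbeats kept `… in` (1600000 ×2, 800000 ×1 as in K); per-part private helper copies; statements and proofs otherwise verbatim (no renames). `--supports stmt-Schanuel-24622`; no census credit carried; rung 0 — nothing here proves Schanuel; no ∀-item moves.)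
-/

noncomputable section
open Complex
namespace Summit.Schanuel.Schanuel.Theorems.RootDecomp1BProductCell
open MvPolynomial
open Summit.Schanuel.Schanuel.Theorems.RootDecomp1KHyper (mvlen mvlen_nonneg one_le_mvlen abs_coeff_le_mvlen)
open RootDecomp1BRadicalDescent (resFin DExpMeasure UltraLiouville exists_int_relation norm_mvaeval_le_mvlen
  totalDegree_det_le mvlen_det_le adjugate_bounds)
open RootDecomp1BTwoRadical (sX₃ sX₃_apply eq_of_parts₃ Cf₂ Frel₂ Frel₂_eq_aeval radMat₂ det_radMat₂_ne_zero
  det_eq_eigen_mul₂ eigen_eq_Frel₂ mvlen_radMat₂_le totalDegree_radMat₂_le mvlen_Cf₂_le twoRadical_clash)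
variable {n : ℕ}

/-! ## §3b The upper half of the clash, with an abstract small factor (for the OUTER descent of §5) -/

section OuterUpper

/-- `x^k ≤ exp(k·x)` for `x ≥ 0`. -/
private theorem pow_le_exp_mul {x : ℝ} (hx : 0 ≤ x) (k : ℕ) : x ^ k ≤ Real.exp (k * x) := by
  rw [Real.exp_nat_mul]
  exact pow_le_pow_left₀ hx (by linarith [Real.add_one_le_exp x]) k

/-- **Upper bound of the norm form from the eigen-factorisation** — step (4) of the tree's `twoRadical_clash`
VERBATIM, but with the small factor `dJ` kept abstract (no tower shape imposed): over ANY base point `θ` with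
`‖θ_i‖ ≤ Θ`, `‖N(θ)‖ ≤ (Kl + 1) · exp(cU · (q²)²) · dJ`. (In §5 the base point is the transcendental `θ_σ` and
`dJ = |r − ρ|`.) -/
theorem norm_normForm_le {q : ℕ} (hq : 0 < q) {θ : Fin n → ℂ}
    {N : MvPolynomial (Fin n) ℤ}
    {M : Matrix (Fin (q * q)) (Fin (q * q)) (MvPolynomial (Fin n) ℤ)} {Mθ : Matrix (Fin (q * q)) (Fin (q * q)) ℂ}
    (hdet : Mθ.det = aeval θ N) {z : Fin (q * q)}
    (hadj : ∀ a' : Fin (q * q), Mθ.adjugate z a' = aeval θ (M.adjugate z a'))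
    {E : ℤ} (hE1 : 1 ≤ E) {δe : ℕ}
    (hadjB : ∀ a' : Fin (q * q), mvlen (M.adjugate z a') ≤ ((q * q).factorial : ℤ) * E ^ (q * q) ∧
      (M.adjugate z a').totalDegree ≤ (q * q) * δe)
    {Θ : ℝ} (hΘ1 : 1 ≤ Θ) (hθΘ : ∀ i, ‖θ i‖ ≤ Θ) {w : Fin (q * q) → ℂ} (hw : ∀ a', ‖w a'‖ ≤ Θ ^ q * Θ ^ q)
    {Φ : ℂ} (hfact : Mθ.det = Φ * ∑ a' : Fin (q * q), Mθ.adjugate z a' * w a')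
    {Kl dJ : ℝ} (hKl : 0 ≤ Kl) (hd0 : 0 ≤ dJ) {J : ℕ} (hΦ : ‖Φ‖ ≤ (q : ℝ) ^ J * (Kl * dJ))
    {K p Bρ : ℕ} {LP : ℤ} (hLP1 : 1 ≤ LP) (hpB : p ≤ Bρ * q)
    (hEdef : E = ((K : ℤ) + 1) ^ 2 * (LP * ((p : ℤ) + q) ^ J))
    {cE cU : ℝ} (hcE : cE = 2 * ((K : ℝ) + 1) + LP + J * ((Bρ : ℝ) + 1))
    (hcU : cU = ((J : ℝ) + 2) + cE + Θ * ((δe : ℝ) + 2)) :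
    ‖aeval θ N‖ ≤ (Kl + 1) * Real.exp (cU * ((q : ℝ) ^ 2) ^ 2) * dJ := by
  have hq1r : (1 : ℝ) ≤ q := by exact_mod_cast hq
  have hq0r : (0 : ℝ) < q := by positivity
  have hqsq : (q : ℝ) ≤ (q : ℝ) ^ 2 := by nlinarith only [hq1r]
  have hq2 : (1 : ℝ) ≤ (q : ℝ) ^ 2 := hq1r.trans hqsq
  have hQcast : ((q * q : ℕ) : ℝ) = (q : ℝ) ^ 2 := by push_cast; ring
  have hQsq : (q : ℝ) ^ 2 ≤ ((q : ℝ) ^ 2) ^ 2 := by nlinarith only [hq2]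
  have hqQsq : (q : ℝ) ≤ ((q : ℝ) ^ 2) ^ 2 := hqsq.trans hQsq
  have hΘ0 : 0 ≤ Θ := by linarith
  have hLP1r : (1 : ℝ) ≤ LP := by exact_mod_cast hLP1
  have hcE0 : 0 ≤ cE := by rw [hcE]; positivity
  have hEr : (E : ℝ) ≤ Real.exp (2 * ((K : ℝ) + 1) + LP + J * (((Bρ : ℝ) + 1) * q)) := by
    have h1 : ((K : ℝ) + 1) ^ 2 ≤ Real.exp (2 * ((K : ℝ) + 1)) := by
      have := pow_le_exp_mul (show (0:ℝ) ≤ (K : ℝ) + 1 by positivity) 2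
      simpa using this
    have h2 : (LP : ℝ) ≤ Real.exp (LP : ℝ) := by linarith [Real.add_one_le_exp (LP : ℝ)]
    have h3 : ((p : ℝ) + q) ^ J ≤ Real.exp (J * (((Bρ : ℝ) + 1) * q)) := by
      have hpq' : (p : ℝ) + q ≤ ((Bρ : ℝ) + 1) * q := by
        have : (p : ℝ) ≤ Bρ * q := by exact_mod_cast hpB
        linarith
      exact (pow_le_pow_left₀ (by positivity) hpq' J).trans (pow_le_exp_mul (by positivity) J)
    have key : ((K : ℝ) + 1) ^ 2 * ((LP : ℝ) * ((p : ℝ) + q) ^ J) ≤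
        Real.exp (2 * ((K : ℝ) + 1)) * (Real.exp (LP : ℝ) * Real.exp (J * (((Bρ : ℝ) + 1) * q))) :=
      mul_le_mul h1 (mul_le_mul h2 h3 (by positivity) (Real.exp_pos _).le) (by positivity)
        (Real.exp_pos _).le
    have hEcast : (E : ℝ) = ((K : ℝ) + 1) ^ 2 * ((LP : ℝ) * ((p : ℝ) + q) ^ J) := by
      rw [hEdef]; push_cast; ring
    rw [hEcast]
    calc _ ≤ _ := key
      _ = Real.exp (2 * ((K : ℝ) + 1) + LP + J * (((Bρ : ℝ) + 1) * q)) := by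
          rw [← Real.exp_add, ← Real.exp_add]; congr 1; ring
  have hE0r : (0 : ℝ) ≤ E := by exact_mod_cast (zero_le_one.trans hE1)
  have hEq : (E : ℝ) ^ (q * q) ≤ Real.exp (cE * ((q : ℝ) ^ 2) ^ 2) := by
    refine (pow_le_pow_left₀ hE0r hEr (q * q)).trans ?_
    rw [← Real.exp_nat_mul, Real.exp_le_exp, hQcast, hcE]
    have t1 : (2 * ((K : ℝ) + 1)) * (q : ℝ) ^ 2 ≤ (2 * ((K : ℝ) + 1)) * ((q : ℝ) ^ 2) ^ 2 :=
      mul_le_mul_of_nonneg_left hQsq (by positivity)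
    have t2 : (LP : ℝ) * (q : ℝ) ^ 2 ≤ (LP : ℝ) * ((q : ℝ) ^ 2) ^ 2 := mul_le_mul_of_nonneg_left hQsq (by linarith)
    have t3 : (q : ℝ) ^ 2 * (J * (((Bρ : ℝ) + 1) * q)) ≤ J * ((Bρ : ℝ) + 1) * ((q : ℝ) ^ 2) ^ 2 := by
      have : (q : ℝ) ^ 2 * q ≤ (q : ℝ) ^ 2 * (q : ℝ) ^ 2 := mul_le_mul_of_nonneg_left hqsq (by positivity)
      nlinarith only [this, show (0:ℝ) ≤ J * ((Bρ : ℝ) + 1) by positivity]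
    nlinarith only [t1, t2, t3]
  have hfac : (((q * q).factorial : ℕ) : ℝ) ≤ Real.exp (((q : ℝ) ^ 2) ^ 2) := by
    have h1 : (((q * q).factorial : ℕ) : ℝ) ≤ ((q * q : ℕ) : ℝ) ^ (q * q) := by
      exact_mod_cast Nat.factorial_le_pow (q * q)
    refine h1.trans ?_
    rw [hQcast]
    refine (pow_le_exp_mul (by positivity) (q * q)).trans (le_of_eq ?_)
    rw [hQcast, sq ((q : ℝ) ^ 2)]
  have hΘpow : ∀ k : ℕ, Θ ^ k ≤ Real.exp (k * Θ) := fun k => pow_le_exp_mul hΘ0 k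
  set T : ℝ := ((((q * q).factorial : ℕ) : ℝ) * (E : ℝ) ^ (q * q)) * Θ ^ ((q * q) * δe) * (Θ ^ q * Θ ^ q)
    with hT
  have hS : ‖∑ a' : Fin (q * q), Mθ.adjugate z a' * w a'‖ ≤ ((q * q : ℕ) : ℝ) * T := by
    refine (norm_sum_le _ _).trans ?_
    have hterm : ∀ a' : Fin (q * q), ‖Mθ.adjugate z a' * w a'‖ ≤ T := by
      intro a'
      rw [norm_mul, hadj, hT]
      have h1 := norm_mvaeval_le_mvlen (M.adjugate z a') θ hΘ1 hθΘ
      have h2 : (mvlen (M.adjugate z a') : ℝ) ≤ (((q * q).factorial : ℕ) : ℝ) * (E : ℝ) ^ (q * q) := by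
        exact_mod_cast (hadjB a').1
      have h3 : Θ ^ (M.adjugate z a').totalDegree ≤ Θ ^ ((q * q) * δe) :=
        pow_le_pow_right₀ hΘ1 (hadjB a').2
      have h4 : ‖w a'‖ ≤ Θ ^ q * Θ ^ q := hw a'
      have h0 : (0 : ℝ) ≤ (mvlen (M.adjugate z a') : ℝ) := by exact_mod_cast mvlen_nonneg _
      calc ‖aeval θ (M.adjugate z a')‖ * ‖w a'‖
          ≤ ((mvlen (M.adjugate z a') : ℝ) * Θ ^ (M.adjugate z a').totalDegree) * (Θ ^ q * Θ ^ q) :=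
            mul_le_mul h1 h4 (by positivity) (by positivity)
        _ ≤ ((((q * q).factorial : ℕ) : ℝ) * (E : ℝ) ^ (q * q)) * Θ ^ ((q * q) * δe) * (Θ ^ q * Θ ^ q) := by
            refine mul_le_mul_of_nonneg_right ?_ (by positivity)
            exact mul_le_mul h2 h3 (by positivity) (by positivity)
    calc ∑ a' : Fin (q * q), ‖Mθ.adjugate z a' * w a'‖
        ≤ ∑ _a' : Fin (q * q), T := Finset.sum_le_sum fun a' _ => hterm a'
      _ = ((q * q : ℕ) : ℝ) * T := by
          rw [Finset.sum_const, Finset.card_univ, Fintype.card_fin, nsmul_eq_mul]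
  have hT0 : 0 ≤ T := by rw [hT]; positivity
  have hjunk : (q : ℝ) ^ J * (((q * q : ℕ) : ℝ) * T) ≤ Real.exp (cU * ((q : ℝ) ^ 2) ^ 2) := by
    have h1 : (q : ℝ) ^ J ≤ Real.exp (J * ((q : ℝ) ^ 2) ^ 2) :=
      (pow_le_exp_mul hq0r.le J).trans (by
        rw [Real.exp_le_exp]; exact mul_le_mul_of_nonneg_left hqQsq (Nat.cast_nonneg J))
    have h2 : ((q * q : ℕ) : ℝ) ≤ Real.exp (((q : ℝ) ^ 2) ^ 2) := by
      rw [hQcast]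
      exact (by linarith [Real.add_one_le_exp ((q : ℝ) ^ 2)] : (q : ℝ) ^ 2 ≤ Real.exp ((q : ℝ) ^ 2)).trans
        (Real.exp_le_exp.2 hQsq)
    have h3 := hfac
    have h4 := hEq
    have h5 : Θ ^ ((q * q) * δe) * (Θ ^ q * Θ ^ q) ≤ Real.exp (Θ * (((δe : ℝ) + 2)) * ((q : ℝ) ^ 2) ^ 2) := by
      rw [← pow_add, ← pow_add]
      refine (hΘpow _).trans ?_
      rw [Real.exp_le_exp]
      push_cast
      have e1 : (q : ℝ) * q * δe ≤ ((q : ℝ) ^ 2) ^ 2 * δe := by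
        rw [← sq]; exact mul_le_mul_of_nonneg_right hQsq (Nat.cast_nonneg δe)
      calc ((q : ℝ) * q * δe + (q + q)) * Θ = ((q : ℝ) * q * δe + q + q) * Θ := by ring
        _ ≤ (((q : ℝ) ^ 2) ^ 2 * δe + ((q : ℝ) ^ 2) ^ 2 + ((q : ℝ) ^ 2) ^ 2) * Θ :=
            mul_le_mul_of_nonneg_right (by linarith) hΘ0
        _ = Θ * ((δe : ℝ) + 2) * ((q : ℝ) ^ 2) ^ 2 := by ring
    calc (q : ℝ) ^ J * (((q * q : ℕ) : ℝ) * T)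
        = (q : ℝ) ^ J * ((q * q : ℕ) : ℝ) * (((q * q).factorial : ℕ) : ℝ) * (E : ℝ) ^ (q * q) *
            (Θ ^ ((q * q) * δe) * (Θ ^ q * Θ ^ q)) := by rw [hT]; ring
      _ ≤ Real.exp (J * ((q : ℝ) ^ 2) ^ 2) * Real.exp (((q : ℝ) ^ 2) ^ 2) * Real.exp (((q : ℝ) ^ 2) ^ 2) *
          Real.exp (cE * ((q : ℝ) ^ 2) ^ 2) * Real.exp (Θ * ((δe : ℝ) + 2) * ((q : ℝ) ^ 2) ^ 2) := by
          gcongr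
      _ = Real.exp (cU * ((q : ℝ) ^ 2) ^ 2) := by
          simp only [← Real.exp_add]; congr 1; rw [hcU]; ring
  calc ‖aeval θ N‖ = ‖Mθ.det‖ := by rw [hdet]
    _ = ‖Φ‖ * ‖∑ a' : Fin (q * q), Mθ.adjugate z a' * w a'‖ := by rw [hfact, norm_mul]
    _ ≤ ((q : ℝ) ^ J * (Kl * dJ)) * (((q * q : ℕ) : ℝ) * T) :=
        mul_le_mul hΦ hS (by positivity) (by positivity)
    _ = Kl * ((q : ℝ) ^ J * (((q * q : ℕ) : ℝ) * T)) * dJ := by ring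
    _ ≤ (Kl + 1) * Real.exp (cU * ((q : ℝ) ^ 2) ^ 2) * dJ := by
        refine mul_le_mul_of_nonneg_right (mul_le_mul (by linarith) hjunk (by positivity) (by positivity)) hd0

/-- **Length and degree of the norm form in closed form**: `mvlen N ≤ exp((1 + cE)·(q²)²)` (as reals) — the
`(q²)! · E^{q²}` bound of the tree made exponential (step (3) of `twoRadical_clash`, extracted). -/
theorem normForm_len_le {q : ℕ} (hq : 0 < q) {N : MvPolynomial (Fin n) ℤ} {E : ℤ} (hE1 : 1 ≤ E)
    (hNlen : mvlen N ≤ ((q * q).factorial : ℤ) * E ^ (q * q))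
    {K p Bρ J : ℕ} {LP : ℤ} (hLP1 : 1 ≤ LP) (hpB : p ≤ Bρ * q)
    (hEdef : E = ((K : ℤ) + 1) ^ 2 * (LP * ((p : ℤ) + q) ^ J))
    {cE : ℝ} (hcE : cE = 2 * ((K : ℝ) + 1) + LP + J * ((Bρ : ℝ) + 1)) :
    (mvlen N : ℝ) ≤ Real.exp ((1 + cE) * ((q : ℝ) ^ 2) ^ 2) := by
  have hq1r : (1 : ℝ) ≤ q := by exact_mod_cast hq
  have hq0r : (0 : ℝ) < q := by positivity
  have hqsq : (q : ℝ) ≤ (q : ℝ) ^ 2 := by nlinarith only [hq1r]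
  have hq2 : (1 : ℝ) ≤ (q : ℝ) ^ 2 := hq1r.trans hqsq
  have hQcast : ((q * q : ℕ) : ℝ) = (q : ℝ) ^ 2 := by push_cast; ring
  have hQsq : (q : ℝ) ^ 2 ≤ ((q : ℝ) ^ 2) ^ 2 := by nlinarith only [hq2]
  have hLP1r : (1 : ℝ) ≤ LP := by exact_mod_cast hLP1
  have hEr : (E : ℝ) ≤ Real.exp (2 * ((K : ℝ) + 1) + LP + J * (((Bρ : ℝ) + 1) * q)) := by
    have h1 : ((K : ℝ) + 1) ^ 2 ≤ Real.exp (2 * ((K : ℝ) + 1)) := by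
      have := pow_le_exp_mul (show (0:ℝ) ≤ (K : ℝ) + 1 by positivity) 2
      simpa using this
    have h2 : (LP : ℝ) ≤ Real.exp (LP : ℝ) := by linarith [Real.add_one_le_exp (LP : ℝ)]
    have h3 : ((p : ℝ) + q) ^ J ≤ Real.exp (J * (((Bρ : ℝ) + 1) * q)) := by
      have hpq' : (p : ℝ) + q ≤ ((Bρ : ℝ) + 1) * q := by
        have : (p : ℝ) ≤ Bρ * q := by exact_mod_cast hpB
        linarith
      exact (pow_le_pow_left₀ (by positivity) hpq' J).trans (pow_le_exp_mul (by positivity) J)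
    have key : ((K : ℝ) + 1) ^ 2 * ((LP : ℝ) * ((p : ℝ) + q) ^ J) ≤
        Real.exp (2 * ((K : ℝ) + 1)) * (Real.exp (LP : ℝ) * Real.exp (J * (((Bρ : ℝ) + 1) * q))) :=
      mul_le_mul h1 (mul_le_mul h2 h3 (by positivity) (Real.exp_pos _).le) (by positivity)
        (Real.exp_pos _).le
    have hEcast : (E : ℝ) = ((K : ℝ) + 1) ^ 2 * ((LP : ℝ) * ((p : ℝ) + q) ^ J) := by
      rw [hEdef]; push_cast; ring
    rw [hEcast]
    calc _ ≤ _ := key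
      _ = Real.exp (2 * ((K : ℝ) + 1) + LP + J * (((Bρ : ℝ) + 1) * q)) := by
          rw [← Real.exp_add, ← Real.exp_add]; congr 1; ring
  have hE0r : (0 : ℝ) ≤ E := by exact_mod_cast (zero_le_one.trans hE1)
  have hEq : (E : ℝ) ^ (q * q) ≤ Real.exp (cE * ((q : ℝ) ^ 2) ^ 2) := by
    refine (pow_le_pow_left₀ hE0r hEr (q * q)).trans ?_
    rw [← Real.exp_nat_mul, Real.exp_le_exp, hQcast, hcE]
    have t1 : (2 * ((K : ℝ) + 1)) * (q : ℝ) ^ 2 ≤ (2 * ((K : ℝ) + 1)) * ((q : ℝ) ^ 2) ^ 2 :=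
      mul_le_mul_of_nonneg_left hQsq (by positivity)
    have t2 : (LP : ℝ) * (q : ℝ) ^ 2 ≤ (LP : ℝ) * ((q : ℝ) ^ 2) ^ 2 := mul_le_mul_of_nonneg_left hQsq (by linarith)
    have t3 : (q : ℝ) ^ 2 * (J * (((Bρ : ℝ) + 1) * q)) ≤ J * ((Bρ : ℝ) + 1) * ((q : ℝ) ^ 2) ^ 2 := by
      have : (q : ℝ) ^ 2 * q ≤ (q : ℝ) ^ 2 * (q : ℝ) ^ 2 := mul_le_mul_of_nonneg_left hqsq (by positivity)
      nlinarith only [this, show (0:ℝ) ≤ J * ((Bρ : ℝ) + 1) by positivity]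
    nlinarith only [t1, t2, t3]
  have hfac : (((q * q).factorial : ℕ) : ℝ) ≤ Real.exp (((q : ℝ) ^ 2) ^ 2) := by
    have h1 : (((q * q).factorial : ℕ) : ℝ) ≤ ((q * q : ℕ) : ℝ) ^ (q * q) := by
      exact_mod_cast Nat.factorial_le_pow (q * q)
    refine h1.trans ?_
    rw [hQcast]
    refine (pow_le_exp_mul (by positivity) (q * q)).trans (le_of_eq ?_)
    rw [hQcast, sq ((q : ℝ) ^ 2)]
  have h1 : (mvlen N : ℝ) ≤ (((q * q).factorial : ℕ) : ℝ) * (E : ℝ) ^ (q * q) := by exact_mod_cast hNlen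
  refine h1.trans ((mul_le_mul hfac hEq (by positivity) (Real.exp_pos _).le).trans (le_of_eq ?_))
  rw [← Real.exp_add]; congr 1; ring

end OuterUpper

end Summit.Schanuel.Schanuel.Theorems.RootDecomp1BProductCell

end
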